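import Summits.Parity.GeneralizedHardyLittlewood.Theses.ZDegreeToeplitzBand
import HarnessLib

/-!
# 𝒳₂ `LongPairsGradedTables` (stmt-Parity-20446): what a falsifier can and cannot be (refuter desk, negative lemmas)

Route `ZDegreeToeplitzBand`, crux 𝒳₂ = `LongPairsGradedTables` (HELD). Each of its three tables is an
(A)-GUARDED eventual statement (`ForAllLarge fun D _ χ => AssumptionA D χ → ‖cell − X·𝔞𝔓‖ ≤ ε·𝔞𝔓`), so:

* `not_notAEventually_of_not_longPairsGradedTables` / `assumptionA_io_of_not_longPairsGradedTables` — ANY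
  kernel refutation `¬LongPairsGradedTables` exhibits Assumption (A) (`L(1,χ) < log⁻²⁰²² D`) for infinitely
  many real primitive characters: the item holds with the ZERO functionals on the horn where (A) fails
  eventually (as in the tree's `Theorems.children_of_notAEventually`). A desk falsifier of 𝒳₂ is therefore a
  MODEL-LEVEL instrument (a statement about displayed main terms), never a kernel `¬`.
* `displayConverges_of_crossTablePsiOn` (generic) and `longDisplayConverges_of_longPairsGradedTables` — the
  logical ceiling of the «D-periodicity» falsifier F1: if a long cross cell has a DISPLAYED (A)-guarded main term
  `M(D,χ)·𝔞𝔓` (any `M`, D-dependent or not) and 𝒳₂ holds with functional `X₁`, then `‖M(D,χ) − X₁(f,g)‖·𝔞𝔓 ≤ ε·𝔞𝔓`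
  under (A), eventually, for every `ε > 0` — i.e. 𝒳₂ does not contradict a D-dependent display, it converts into
  «the displayed main term CONVERGES along (A)-characters» (equivalently: (A)-characters eventually avoid the
  moduli where `M` is far from one value). A D-free display PROVES the degree-1 part of 𝒳₂ outright; a
  D-dependent one makes 𝒳₂ undecidable in kernel short of the summit (dormant), not refuted.
* `crossTablePsiOn_of_confinedDisplay` / `crossTablePsiOn_iff_confined_of_display` — the converse and the
  dichotomy as a theorem: GIVEN a display family `M` for the cells of a class, the table with a D-free `X` is
  EQUIVALENT to the eventual confinement of `M` to `X` along (A)-characters (LIVE-PROVABLE iff `M` is D-free;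
  DORMANT-BY-LOGIC otherwise).

No definition is declared; standard axioms. «The programme SEARCHES and TYPES; no claim about Landau–Siegel
zeros, Theorems 1–2 of arXiv:2211.02515 or a repaired Margin232 until a kernel theorem says so.»

## References

* [Zhang2022LandauSiegel] Y. Zhang, Discrete mean estimates and the Landau–Siegel zero, arXiv:2211.02515v1
  (2022): §2 p. 4 (Assumption (A), «for large D»), §8 (8.5), Lemma 8.1.
-/

namespace Summit.Parity.GeneralizedHardyLittlewood.Theorems.LongPairsGradedTables.Negative

open ComplexConjugate
open Literature.NumberTheory.LFunctions.Zhang2022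
open Literature.NumberTheory.LFunctions.Zhang2022.Skeleton
open Literature.NumberTheory.LFunctions.Zhang2022.KnifeEdge
open Summit.Parity.GeneralizedHardyLittlewood.Theses.ZDegreeToeplitzBand

/-- Refuting 𝒳₂ is exhibiting (A) infinitely often: `LongPairsGradedTables` holds (zero functionals, threshold `0`)
whenever (A) fails for all large moduli. [cite: Zhang2022LandauSiegel, §2 p. 4, §8 (8.5)] -/
theorem not_notAEventually_of_not_longPairsGradedTables (h : ¬ LongPairsGradedTables) :
    ¬ ForAllLarge fun D _ χ => ¬ AssumptionA D χ :=
  fun hA => h ⟨0, fun _ _ => ⟨0, 0, 0, (crossTablePsi_of_notAEventually hA 1 0).on _,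
    (dualCrossTablePsi_of_notAEventually hA 1 0).on _, tauTwoTablePsi_of_notAEventually hA 0⟩⟩

/-- The same, spelled out: a refutation of 𝒳₂ yields, beyond every `D₀`, a real primitive character `χ (mod D)`,
`D ≥ D₀`, with `‖L(1,χ)‖ < 1/log²⁰²² D`. [cite: Zhang2022LandauSiegel, §2 p. 4 Assumption (A)] -/
theorem assumptionA_io_of_not_longPairsGradedTables (h : ¬ LongPairsGradedTables) (D₀ : ℕ) :
    ∃ (D : ℕ) (_ : NeZero D) (χ : DirichletCharacter ℂ D),
      D₀ ≤ D ∧ χ.IsQuadratic ∧ χ.IsPrimitive ∧ AssumptionA D χ := by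
  by_contra hc
  exact not_notAEventually_of_not_longPairsGradedTables h
    ⟨D₀, fun D _ χ hD hq hp hA => hc ⟨D, ‹_›, χ, hD, hq, hp, hA⟩⟩

/-- **Generic convergence of a displayed main term along (A)-characters.** If a restricted ψ-graded cross table of
degree `d` holds with the (D-free) functional `X`, and the same cell has an (A)-guarded eventual display with a
possibly `D`- and `χ`-dependent main term `M D χ`, then `‖M D χ − X(f,g)‖·𝔞𝔓 ≤ ε·𝔞𝔓` under (A), eventually, for
every `ε > 0`. [cite: Zhang2022LandauSiegel, §8 (8.5), Lemma 8.1] -/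
theorem displayConverges_of_crossTablePsiOn {c' : ℝ} {𝒞 : PairClass} {d : ℕ} {X : PairFunctional}
    (hT : CrossTablePsiOn c' 𝒞 d X) {f f' g g' : ℝ → ℂ} (hf : InClassPiece f f') (hg : InClassPiece g g')
    (h𝒞 : 𝒞 f f' g g') (M : (D : ℕ) → DirichletCharacter ℂ D → ℂ)
    (hM : ∀ ε : ℝ, 0 < ε → ForAllLarge fun D _ χ => AssumptionA D χ →
      ‖zDegMeanPsi c' χ d (fun x t => conj (profPoly χ x g (⌊bigP D⌋₊ + 1) t))
            (fun x t => profPoly χ x f (⌊bigP D⌋₊ + 1) t)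
          - M D χ * frakA χ * frakP D‖ ≤ ε * frakA χ * frakP D) :
    ∀ ε : ℝ, 0 < ε → ForAllLarge fun D _ χ => AssumptionA D χ →
      ‖M D χ - X f f' g g'‖ * (frakA χ * frakP D) ≤ ε * (frakA χ * frakP D) := by
  intro ε hε
  have h1 := hT f f' g g' hf hg h𝒞 (ε / 2) (by positivity)
  have h2 := hM (ε / 2) (by positivity)
  refine (h1.and h2).mono fun D _ χ _ _ h hA => ?_
  obtain ⟨e1, e2⟩ := h
  have e1 := e1 hA
  have e2 := e2 hA
  have hAP : 0 ≤ frakA χ * frakP D := mul_nonneg (frakA_nonneg χ) (frakP_nonneg D)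
  set τ := zDegMeanPsi c' χ d (fun x t => conj (profPoly χ x g (⌊bigP D⌋₊ + 1) t))
      (fun x t => profPoly χ x f (⌊bigP D⌋₊ + 1) t) with hτ
  have key : (M D χ - X f f' g g') * ((frakA χ * frakP D : ℝ) : ℂ) =
      (τ - X f f' g g' * frakA χ * frakP D) - (τ - M D χ * frakA χ * frakP D) := by
    push_cast; ring
  calc ‖M D χ - X f f' g g'‖ * (frakA χ * frakP D)
      = ‖(M D χ - X f f' g g') * ((frakA χ * frakP D : ℝ) : ℂ)‖ := by
        rw [norm_mul, Complex.norm_real, Real.norm_of_nonneg hAP]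
    _ = ‖(τ - X f f' g g' * frakA χ * frakP D) - (τ - M D χ * frakA χ * frakP D)‖ := by rw [key]
    _ ≤ ‖τ - X f f' g g' * frakA χ * frakP D‖ + ‖τ - M D χ * frakA χ * frakP D‖ := norm_sub_le _ _
    _ ≤ ε / 2 * frakA χ * frakP D + ε / 2 * frakA χ * frakP D := add_le_add e1 e2
    _ = ε * (frakA χ * frakP D) := by ring

/-- **𝒳₂'s degree-1 long cross cell: a display converges along (A)-characters** — the logical ceiling of the
D-periodicity desk falsifier F1. If `LongPairsGradedTables` holds then, for all large `c′`, its functional `X₁`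
satisfies: for every NON-short in-class pair and every (A)-guarded display `M(D,χ)·𝔞𝔓` of the degree-1 cross cell,
`‖M(D,χ) − X₁(f,g)‖·𝔞𝔓 ≤ ε·𝔞𝔓` under (A), eventually. A D-dependent `M` thus yields confinement of (A)-characters,
not `¬LongPairsGradedTables`. [cite: Zhang2022LandauSiegel, §8 (8.5), Lemma 8.1] -/
theorem longDisplayConverges_of_longPairsGradedTables (h : LongPairsGradedTables) :
    ∃ c₀ : ℝ, ∀ c' : ℝ, c₀ ≤ c' → ∃ X₁ : PairFunctional,
      ∀ (f f' g g' : ℝ → ℂ), InClassPiece f f' → InClassPiece g g' → ¬ ShortPairs f f' g g' →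
      ∀ (M : (D : ℕ) → DirichletCharacter ℂ D → ℂ),
        (∀ ε : ℝ, 0 < ε → ForAllLarge fun D _ χ => AssumptionA D χ →
          ‖zDegMeanPsi c' χ (1 : ℕ) (fun x t => conj (profPoly χ x g (⌊bigP D⌋₊ + 1) t))
                (fun x t => profPoly χ x f (⌊bigP D⌋₊ + 1) t)
              - M D χ * frakA χ * frakP D‖ ≤ ε * frakA χ * frakP D) →
        ∀ ε : ℝ, 0 < ε → ForAllLarge fun D _ χ => AssumptionA D χ →
          ‖M D χ - X₁ f f' g g'‖ * (frakA χ * frakP D) ≤ ε * (frakA χ * frakP D) := by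
  obtain ⟨c₀, hc₀⟩ := h
  refine ⟨c₀, fun c' hc' => ?_⟩
  obtain ⟨X₁, Y₁, X₂, hX, -, -⟩ := hc₀ c' hc'
  exact ⟨X₁, fun f f' g g' hf hg hns M hM => displayConverges_of_crossTablePsiOn hX hf hg hns M hM⟩

/-- **Converse: a CONFINED display proves the table.** If every in-class pair of the class `𝒞` has an (A)-guarded
eventual display of its degree-`d` cross cell with main term `M(f,f′,g,g′; D, χ)·𝔞𝔓`, and along (A)-characters
`M` is eventually within `ε` of a `D`-free functional `X` (in the weighted form `‖M − X‖·𝔞𝔓 ≤ ε·𝔞𝔓`), then the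
restricted cross table holds with functional `X`. In particular a `D`-FREE display (`M = X`) proves the table
outright. [cite: Zhang2022LandauSiegel, §8 (8.5), Lemma 8.1] -/
theorem crossTablePsiOn_of_confinedDisplay {c' : ℝ} {𝒞 : PairClass} {d : ℕ} {X : PairFunctional}
    (M : (ℝ → ℂ) → (ℝ → ℂ) → (ℝ → ℂ) → (ℝ → ℂ) → (D : ℕ) → DirichletCharacter ℂ D → ℂ)
    (hM : ∀ (f f' g g' : ℝ → ℂ), InClassPiece f f' → InClassPiece g g' → 𝒞 f f' g g' →
      ∀ ε : ℝ, 0 < ε → ForAllLarge fun D _ χ => AssumptionA D χ →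
        ‖zDegMeanPsi c' χ d (fun x t => conj (profPoly χ x g (⌊bigP D⌋₊ + 1) t))
              (fun x t => profPoly χ x f (⌊bigP D⌋₊ + 1) t)
            - M f f' g g' D χ * frakA χ * frakP D‖ ≤ ε * frakA χ * frakP D)
    (hconf : ∀ (f f' g g' : ℝ → ℂ), InClassPiece f f' → InClassPiece g g' → 𝒞 f f' g g' →
      ∀ ε : ℝ, 0 < ε → ForAllLarge fun D _ χ => AssumptionA D χ →
        ‖M f f' g g' D χ - X f f' g g'‖ * (frakA χ * frakP D) ≤ ε * (frakA χ * frakP D)) :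
    CrossTablePsiOn c' 𝒞 d X := by
  intro f f' g g' hf hg h𝒞 ε hε
  have h1 := hM f f' g g' hf hg h𝒞 (ε / 2) (by positivity)
  have h2 := hconf f f' g g' hf hg h𝒞 (ε / 2) (by positivity)
  refine (h1.and h2).mono fun D _ χ _ _ h hA => ?_
  obtain ⟨e1, e2⟩ := h
  have e1 := e1 hA
  have e2 := e2 hA
  have hAP : 0 ≤ frakA χ * frakP D := mul_nonneg (frakA_nonneg χ) (frakP_nonneg D)
  set τ := zDegMeanPsi c' χ d (fun x t => conj (profPoly χ x g (⌊bigP D⌋₊ + 1) t))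
      (fun x t => profPoly χ x f (⌊bigP D⌋₊ + 1) t) with hτ
  have key : τ - X f f' g g' * frakA χ * frakP D =
      (τ - M f f' g g' D χ * frakA χ * frakP D)
        + (M f f' g g' D χ - X f f' g g') * ((frakA χ * frakP D : ℝ) : ℂ) := by
    push_cast; ring
  have hn : ‖(M f f' g g' D χ - X f f' g g') * ((frakA χ * frakP D : ℝ) : ℂ)‖
      = ‖M f f' g g' D χ - X f f' g g'‖ * (frakA χ * frakP D) := by
    rw [norm_mul, Complex.norm_real, Real.norm_of_nonneg hAP]
  calc ‖τ - X f f' g g' * frakA χ * frakP D‖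
      = ‖(τ - M f f' g g' D χ * frakA χ * frakP D)
          + (M f f' g g' D χ - X f f' g g') * ((frakA χ * frakP D : ℝ) : ℂ)‖ := by rw [key]
    _ ≤ ‖τ - M f f' g g' D χ * frakA χ * frakP D‖
          + ‖(M f f' g g' D χ - X f f' g g') * ((frakA χ * frakP D : ℝ) : ℂ)‖ := norm_add_le _ _
    _ ≤ ε / 2 * frakA χ * frakP D + ε / 2 * (frakA χ * frakP D) := by rw [hn]; exact add_le_add e1 e2
    _ = ε * frakA χ * frakP D := by ring

/-- **DORMANT-BY-LOGIC made precise (the desk's dichotomy as a theorem).** GIVEN a display family `M` for the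
degree-`d` cross cells of a class `𝒞` (the object a DISPLAY writes), the restricted cross table with a `D`-free
functional `X` is EQUIVALENT to the eventual CONFINEMENT of `M` to `X` along (A)-characters (weighted form). So:
`M` `D`-free ⇒ the table is PROVED with `X := M` (LIVE-PROVABLE); `M` genuinely `D`- or `χ`-dependent at order 𝔞𝔓 ⇒
the table says exactly «the (A)-characters eventually avoid the moduli where `M` is far from `X`» — a statement
between `ForAllLarge ¬(A)` and `True` (DORMANT-BY-LOGIC), never a kernel `¬`. The dual cross table and the full
`τ₂` table have the same dichotomy verbatim. [cite: Zhang2022LandauSiegel, §8 (8.5), Lemma 8.1] -/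
theorem crossTablePsiOn_iff_confined_of_display {c' : ℝ} {𝒞 : PairClass} {d : ℕ} {X : PairFunctional}
    (M : (ℝ → ℂ) → (ℝ → ℂ) → (ℝ → ℂ) → (ℝ → ℂ) → (D : ℕ) → DirichletCharacter ℂ D → ℂ)
    (hM : ∀ (f f' g g' : ℝ → ℂ), InClassPiece f f' → InClassPiece g g' → 𝒞 f f' g g' →
      ∀ ε : ℝ, 0 < ε → ForAllLarge fun D _ χ => AssumptionA D χ →
        ‖zDegMeanPsi c' χ d (fun x t => conj (profPoly χ x g (⌊bigP D⌋₊ + 1) t))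
              (fun x t => profPoly χ x f (⌊bigP D⌋₊ + 1) t)
            - M f f' g g' D χ * frakA χ * frakP D‖ ≤ ε * frakA χ * frakP D) :
    CrossTablePsiOn c' 𝒞 d X ↔
      ∀ (f f' g g' : ℝ → ℂ), InClassPiece f f' → InClassPiece g g' → 𝒞 f f' g g' →
        ∀ ε : ℝ, 0 < ε → ForAllLarge fun D _ χ => AssumptionA D χ →
          ‖M f f' g g' D χ - X f f' g g'‖ * (frakA χ * frakP D) ≤ ε * (frakA χ * frakP D) :=
  ⟨fun hT f f' g g' hf hg h𝒞 => displayConverges_of_crossTablePsiOn hT hf hg h𝒞 (M f f' g g') (hM f f' g g' hf hg h𝒞),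
    crossTablePsiOn_of_confinedDisplay M hM⟩

end Summit.Parity.GeneralizedHardyLittlewood.Theorems.LongPairsGradedTables.Negative
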